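import Literature.MathematicalPhysics.QuantumFieldTheory.Balaban1983to89.B9Eq353FormDefectTowerDiagonal
import Literature.MathematicalPhysics.QuantumFieldTheory.Balaban1983to89.B9Eq3126H1LipschitzEnergy

/-!
# `Balaban1983to89.B9Eq3126H1kLipschitzEnergyDiagonal` — T. Bałaban, *Propagators for lattice gauge theories in a background field*, Commun. Math. Phys.
# **99** (1985) 389–434 [Balaban1985BackgroundPropagators] (3.126) p. 420 *«HB = GQ*(QGQ*)⁻¹B»* with Thm 3.4 p. 400 ∕ (3.84)–(3.86) p. 407 AT `k = n+1` AVERAGING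
# LEVELS ON PRINT's DIAGONAL `ηL^{n+1} = 1`: **`H_{1,k}(U) − H_{1,k}(1) = O(α)` IN THE FLAT ENERGY NORM — `∃ α₀ C` BEFORE EVERY LATTICE ∕ HEIGHT ∕ WEIGHT ∕
# VOLUME ∕ BACKGROUND BINDER, MODULO THE `R`-LETTER `C_R` AND THE TWO `(Q_kG_kQ_k†)⁻¹`-LETTERS `C_{K,1}`, `C_{K,U}`** (the owner's `B9Eq353FormDefectTowerDiagonal`
# energy data + `B9Eq3126H1LipschitzEnergy`; the `K`-letters are ne9-leaf-02's `B9Eq3126KFloor*` slots)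

statement-level skeleton of published theorems with citation tags; proofs where landed; nothing here is a claim about the Yang–Mills mass gap

CITATION HEADER (lean-in-tree rule).  Audit cell `pub-balaban`, sub-cell `t4`, BINDER row NE9; filed by the row OWNER lineage `b2b-balaban-t4-ne9-p1`
(gen 86).  Sources READ first-hand in the held text layer [Balaban1985BackgroundPropagators] (`paper:balaban1985-cmp99-background-propagators`, journal page =
PDF page + 388) pp. 400 (Thm 3.4, (3.52)–(3.53)), 407 ((3.82)–(3.86)), 420 ((3.126)); [Balaban1985Variational] (45)–(46) p. 285 via the tree's quotations.
THE PRINT (verbatim): [B9] p. 420 *«HB = GQ*(QGQ*)⁻¹B»*; [B11] p. 285 *«… the Theorem 3.12 from [5] implies |HB| ≤ B₀(L^jη)^{−1}|B|»*; [B9] p. 400 Thm 3.4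
*«small perturbations of the operators depending on U only»*.

WHY THIS FILE (the owner's programme «THE 𝔊-STOREY IN THE ENERGY CURRENCY»).  The chart of `cur U` applies `H_{1,k}(U)` to the block data and is consumed
LIPSCHITZ IN THE BACKGROUND AT THE FLAT POINT (`Support/NE9CurChartLipschitzAtFlat`); the chain's letter (`B9Eq386LipschitzH1TowerTwoBackgrounds`, ne9-leaf-04
g74) lives in the OPERATOR currency (`‖Δ_a‖ ∝ |η|⁻²`, `‖Δ_a(U) − Δ_a(1)‖ ∝ |η|⁻²·window`).  Here: `B9Eq3126H1LipschitzEnergy.norm_apply_H1K_sub_le` (the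
minimiser's exact defect identity) at the energy data of `B9Eq353FormDefectTowerDiagonal` (`γ₁` twice, the form defect `Θ̄α`) and the averaging defect
`C_Qα` (ne9-leaf-02's `norm_QkW_sub_flat_le_L2_geometric`, as in that file): `‖H_{1,k}(U)b − H_{1,k}(1)b‖` and its flat `D`-rows are
`≤ α·((Θ̄√(C_{K,1}∕γ₁) + C_QC_{K,1})∕γ₁ + √(C_{K,U}∕γ₁)·C_Q·√(C_{K,1}∕γ₁))·‖b‖` — LEVEL- AND VOLUME-FREE modulo the two DISPLAYED `K⁻¹`-letters
(`‖(Q_kG_k(1)Q_k†)⁻¹‖ ≤ C_{K,1}`: ne9-leaf-02's `B9Eq3126KFloorTowerDiagonal` gives `Ξ(d,a)`; `‖(Q_kG_k(U)Q_k†)⁻¹‖ ≤ C_{K,U}`: their windowed tent files) and `C_R`.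

WHAT IS PROVED (sorry-free; 0 `def`; [folklore] composition BY NAME; nothing of [B9] asserted as printed).
* **`exists_norm_H1k_sub_flat_le_diagonal_closed`** — `∃ α₀ C > 0` (closed in `(d, a, L, M_φ, M_φ′, r, C_τ, ρ_w, C_R, C_{K,1}, C_{K,U})`) BEFORE the binders of
  `B9Thm311LaplaceAkPositiveDiagonal` + `hR` (the `R`-letter), then for ANY positivity witnesses `hposU`, `hpos1`, ANY onto-witnesses `hQU`, `hQ1` of `Q_k(U)`, `Q_k(1)`,
  the two `K⁻¹`-letters `‖KinvLatticeK … hpos1 hQ1 b‖ ≤ C_{K,1}‖b‖`, `‖KinvLatticeK hposU hQU c‖ ≤ C_{K,U}‖c‖`, and every `b`: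
  `‖H_k(U)b − H_k(1)b‖, ‖curl₁(…)‖, ‖div₁(…)‖ ≤ Cα‖b‖` with `H_k(U) = H1LatticeK hposU hQU` and the flat `H_k(1) = H1LatticeK (c := η⁻¹) (R S := 1) (Δ₁ := hessOp 1)
  (Rr := R_k(1)) (Q := Q_k(1)) hpos1 hQ1` (the implicit letters of the canonical flat tower operator written out — their inference does not terminate within
  default heartbeats; the term is `B9Eq326OperatorTower.H1k … 1 …` definitionally).
HONEST SCOPE.  FIRST order at the flat point on the diagonal ONLY; the `L²`∕energy clause — no kernel bound, no decay, NOT the (N)-reading; the small-field WINDOWS,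
`hRS`, `C_τ`, `ρ_w`, `C_R`, `C_{K,1}`, `C_{K,U}`, the positivity and onto witnesses stay HYPOTHESES; crude constants.  NOT summit progress (cell pub-balaban: NE9 NOT
PRINTED ∕ NOT PROVED; «NE9 ⇐ the named binders»; row WALLED ON A MODEL (O-NE9-1; #5 UNRULED); spine PROVED 0∕9; rung (B)+1 finite T⁴ — NOT infinite volume, NOT mass gap,
NOT BetaPertH, NOT Clay).  HONEST DEPENDENCY (cell line): continuum YM on T⁴ ⇐ BetaPertH ∧ nine spine estimates (0/9 proved); BetaPertH ⇐ (D1) ∧ (D4) ∧ CAP+tail;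
G-an2-4 gates asym, D1 and NE2/3/4.  NEW file; nothing modified.  Net new unproved facts: 0.
-/

noncomputable section

open scoped InnerProductSpace ComplexConjugate BigOperators

namespace Literature.MathematicalPhysics.QuantumFieldTheory.Balaban1983to89.B9Eq3126H1kLipschitzEnergyDiagonal

open B4Sect5Torus (TSite)
open B9SectCLatticeCarrier (Bond)
open B11Eq103H1Complex (SiteL2K BondL2K covDerivL2K covDivL2K laplaceALatticeK laplaceAK H1LatticeK KinvLatticeK H1K KinvK adjoint_injective_of_surjective)
open B9Eq310HessianOperator (adTransportW hessOp covCurlL2K)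
open B9Eq310DeltaPrime (plaqHolU)
open B9Eq315QTorus (perCfg cornerSite)
open B9Eq315QTower (towerP UlevOf)
open B9Eq315QTowerFlat (perCfg_UlevOf_one_mem_U1 norm_Wcx_UlevOf_one_sub_one_le)
open B9Eq326OperatorTower (laplaceAk QkW RofUk)
open B7Prop1Explicit (U1 Wcx boxVec)
open B9Eq315QTowerLipschitzL2 (norm_QkW_sub_flat_le_L2_geometric)
open B9Eq353FormDefectTowerDiagonal (exists_energy_pair_diagonal_closed)
open B9Eq3126H1LipschitzEnergy (norm_apply_H1K_sub_le)

/-! ## §1 Arithmetic -/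

/-- `e^y − 1 ≤ 2y` for `0 ≤ y ≤ 1`. [folklore] -/
private theorem exp_sub_one_le_two_mul {y : ℝ} (hy0 : 0 ≤ y) (hy1 : y ≤ 1) : Real.exp y - 1 ≤ 2 * y := by
  have h := Real.abs_exp_sub_one_le (x := y) (by rw [abs_of_nonneg hy0]; exact hy1)
  rw [abs_of_nonneg hy0] at h
  exact (le_abs_self _).trans h

/-- On the diagonal `c₀(L^{n+1})^d = c₁` the weighted-reading prefactor is `1`. [cite: Balaban1985BackgroundPropagators, (3.16) p.393] -/
private theorem sqrt_ratio_diagonal {d L n : ℕ} {c₀ c₁ : ℝ} (hc₁ : 0 < c₁) (hw : c₀ * ((L : ℝ) ^ (n + 1)) ^ d = c₁) :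
    Real.sqrt (c₁ / (c₀ * ((L : ℝ) ^ (n + 1)) ^ d)) = 1 := by
  rw [hw, div_self hc₁.ne', Real.sqrt_one]

/-- `x ≤ √S` from `0 ≤ x` and `x² ≤ S`. [folklore] -/
private theorem le_sqrt_of_sq_le {x S : ℝ} (hx : 0 ≤ x) (h : x ^ 2 ≤ S) : x ≤ Real.sqrt S := by
  calc x = Real.sqrt (x ^ 2) := (Real.sqrt_sq hx).symm
    _ ≤ Real.sqrt S := Real.sqrt_le_sqrt h

/-! ## §2 `H_{1,k}(U) − H_{1,k}(1)` in the flat energy norm on the diagonal -/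

variable {d : ℕ} (L : ℕ) [NeZero L] (hL : 1 ≤ L)
  {𝔸 : Type*} [NormedRing 𝔸] [NormedAlgebra ℂ 𝔸] [CompleteSpace 𝔸] [NormOneClass 𝔸] [StarRing 𝔸] [NormedStarGroup 𝔸] [StarModule ℂ 𝔸]
  {W : Type*} [NormedAddCommGroup W] [InnerProductSpace ℂ W] [FiniteDimensional ℂ W] (φ : W ≃ₗ[ℂ] 𝔸)
  {Mφ Mφ' : ℝ} (hMφ : 0 ≤ Mφ) (hMφ' : 0 ≤ Mφ') (hφ : ∀ w, ‖φ w‖ ≤ Mφ * ‖w‖) (hφ' : ∀ X, ‖φ.symm X‖ ≤ Mφ' * ‖X‖)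
  {a : ℝ} (ha : 0 < a) {r : ℝ} (hr0 : 0 ≤ r) (hr1 : r < 1)
  (τ : 𝔸 →ₗ[ℂ] ℂ) {Cτ : ℝ} (hτ : ∀ X, ‖τ X‖ ≤ Cτ * ‖X‖) (hCτ : 0 ≤ Cτ) {ρw : ℝ} (hρw : 0 ≤ ρw) {CR : ℝ} (hCR : 0 ≤ CR)
  {CK1 CKU : ℝ} (hCK1 : 0 ≤ CK1) (hCKU : 0 ≤ CKU)

include hMφ hMφ' hφ hφ' ha hr0 hr1 hτ hCτ hρw hCR hCK1 hCKU

-- deep definitional unfolding `H1LatticeK`∕`KinvLatticeK` ↦ `H1K`∕`KinvK` (as in `B9Eq3153FrakGkBoundDiagonal`, `B11Eq174ChartContinuityAtFlat`)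
set_option maxRecDepth 8192 in
/-- **`H_{1,k}(U) − H_{1,k}(1) = O(α)` IN THE FLAT ENERGY NORM ON THE DIAGONAL, MODULO `C_R`, `C_{K,1}`, `C_{K,U}`**: there are `α₀, C > 0` (closed in
`(d, a, L, M_φ, M_φ′, r, C_τ, ρ_w, C_R, C_{K,1}, C_{K,U})`) such that for every `n`, `η` (`ηL^{n+1} = 1`), `c₀, c₁` (`c₀(L^{n+1})^d = c₁`, `|η|^d∕c₀ ≤ ρ_w`), `m`,
background `U` of E162's data with `hRS`, the windows `‖U(b) − 1‖ ≤ αη`, `‖U(∂p) − 1‖ ≤ αη²`, `‖Ū^j(b) − 1‖ ≤ ε_j ≤ αr^j`, `0 ≤ α ≤ α₀`, the `R`-letter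
`‖R_k(U)s − R_k(1)s‖ ≤ C_Rα‖s‖`, ANY positivity witnesses `hposU`, `hpos1`, ANY onto-witnesses `hQU`, `hQ1`, the two `K⁻¹`-letters and every block field `b`:
`‖H_k(U)b − H_k(1)b‖ ≤ Cα‖b‖`, `‖curl₁(H_k(U)b − H_k(1)b)‖ ≤ Cα‖b‖`, `‖div₁(H_k(U)b − H_k(1)b)‖ ≤ Cα‖b‖` — the minimiser's exact defect identity
(`B9Eq3126H1LipschitzEnergy`) at the energy data of `B9Eq353FormDefectTowerDiagonal` and the averaging defect `C_Qα`.  No operator bound of `Δ_a`, `Δ_a(U) − Δ_a(1)`,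
`D`, `Q`; no `H`-letter; no Neumann series. [cite: Balaban1985BackgroundPropagators, (3.126) p.420, Thm 3.4 p.400, (3.84)–(3.86) p.407, Thm 3.11 p.416; Balaban1985Variational, (45)–(46) p.285] -/
theorem exists_norm_H1k_sub_flat_le_diagonal_closed :
    ∃ α₀ C : ℝ, 0 < α₀ ∧ 0 < C ∧ ∀ (n : ℕ) (η : ℝ), η * (L : ℝ) ^ (n + 1) = 1 →
      ∀ (c₀ c₁ : ℝ) [Fact (0 < c₀)] [Fact (0 < c₁)], c₀ * ((L : ℝ) ^ (n + 1)) ^ d = c₁ → |η| ^ d / c₀ ≤ ρw →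
      ∀ (m : Fin d → ℕ) [∀ i, NeZero (m i)] (U : Bond d (towerP L m (n + 1)) → 𝔸ˣ) (αU : ℕ → ℝ) (hα1 : ∀ j, αU j ≤ 1 / 64)
        (hU1 : ∀ (j : ℕ) (x : B7Prop1Explicit.Site d) (κ : Fin d), perCfg (towerP L m (j + 1)) (UlevOf L m (n + 1) U j) x κ ∈ U1 𝔸)
        (hreg : ∀ (j : ℕ) (y : TSite d (towerP L m j)) (κ : Fin d) (r : Fin d → Fin L),
          ‖((Wcx L (perCfg (towerP L m (j + 1)) (UlevOf L m (n + 1) U j)) (cornerSite L y) κ (boxVec L r) : 𝔸ˣ) : 𝔸) - 1‖ ≤ αU j)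
        (εU : ℕ → ℝ), (∀ j, 0 ≤ εU j) → (∀ (j : ℕ) (b : Bond d (towerP L m (j + 1))), ‖(UlevOf L m (n + 1) U j b : 𝔸) - 1‖ ≤ εU j) →
      ∀ {α : ℝ}, 0 ≤ α → α ≤ α₀ →
        (∀ (b : Bond d (towerP L m (n + 1))) (v u : W), ⟪adTransportW φ U b v, u⟫_ℂ = ⟪v, adTransportW φ (fun b => (U b)⁻¹) b u⟫_ℂ) →
        (∀ b, U b ∈ U1 𝔸) → (∀ b, ‖(U b : 𝔸) - 1‖ ≤ α * η) →
        (∀ p : B9SectCLatticeCarrier.Plaq d (towerP L m (n + 1)), ‖(plaqHolU U p : 𝔸) - 1‖ ≤ α * η ^ 2) →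
        (∀ j < n + 1, εU j ≤ α * r ^ j) →
        (∀ s : SiteL2K ℂ d (towerP L m (n + 1)) c₀ W,
          ‖RofUk L m n φ η U s - RofUk L m n φ η (fun _ : Bond d (towerP L m (n + 1)) => (1 : 𝔸ˣ)) s‖ ≤ CR * α * ‖s‖) →
        ∀ (hposU : ∀ x : BondL2K ℂ d (towerP L m (n + 1)) c₀ W, x ≠ 0 →
            0 < RCLike.re ⟪x, laplaceAk L m n φ η U hL αU hα1 hU1 hreg τ (c₀ := c₀) (c₁ := c₁) a x⟫_ℂ)
          (hpos1 : ∀ x : BondL2K ℂ d (towerP L m (n + 1)) c₀ W, x ≠ 0 →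
            0 < RCLike.re ⟪x, laplaceAk L m n φ η (fun _ : Bond d (towerP L m (n + 1)) => (1 : 𝔸ˣ)) hL (fun _ => 0) (fun _ => by norm_num)
              (perCfg_UlevOf_one_mem_U1 L m (n + 1)) (norm_Wcx_UlevOf_one_sub_one_le L m (n + 1) (fun _ => 0) (fun _ => le_rfl)) τ
              (c₀ := c₀) (c₁ := c₁) a x⟫_ℂ)
          (hQU : Function.Surjective (QkW L m n φ U hL αU hα1 hU1 hreg (c₀ := c₀) (c₁ := c₁)))
          (hQ1 : Function.Surjective (QkW L m n φ (fun _ : Bond d (towerP L m (n + 1)) => (1 : 𝔸ˣ)) hL (fun _ => 0) (fun _ => by norm_num)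
            (perCfg_UlevOf_one_mem_U1 L m (n + 1)) (norm_Wcx_UlevOf_one_sub_one_le L m (n + 1) (fun _ => 0) (fun _ => le_rfl)) (c₀ := c₀) (c₁ := c₁))),
        (∀ b : BondL2K ℂ d m c₁ W, ‖KinvLatticeK (c := ((η : ℂ))⁻¹) (R := adTransportW φ (fun _ : Bond d (towerP L m (n + 1)) => (1 : 𝔸ˣ)))
              (S := adTransportW φ fun _ : Bond d (towerP L m (n + 1)) => (1 : 𝔸ˣ)⁻¹) (Δ₁ := hessOp φ η (fun _ : Bond d (towerP L m (n + 1)) => (1 : 𝔸ˣ)) τ)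
              (Rr := RofUk L m n φ η (fun _ : Bond d (towerP L m (n + 1)) => (1 : 𝔸ˣ)))
              (Q := (QkW L m n φ (fun _ : Bond d (towerP L m (n + 1)) => (1 : 𝔸ˣ)) hL (fun _ => 0) (fun _ => by norm_num)
            (perCfg_UlevOf_one_mem_U1 L m (n + 1)) (norm_Wcx_UlevOf_one_sub_one_le L m (n + 1) (fun _ => 0) (fun _ => le_rfl)) (c₀ := c₀) (c₁ := c₁))) (a := a) hpos1 hQ1 b‖ ≤ CK1 * ‖b‖) →
        (∀ c : BondL2K ℂ d m c₁ W, ‖KinvLatticeK hposU hQU c‖ ≤ CKU * ‖c‖) →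
        ∀ b : BondL2K ℂ d m c₁ W,
          ‖H1LatticeK hposU hQU b - H1LatticeK (c := ((η : ℂ))⁻¹) (R := adTransportW φ (fun _ : Bond d (towerP L m (n + 1)) => (1 : 𝔸ˣ)))
              (S := adTransportW φ fun _ : Bond d (towerP L m (n + 1)) => (1 : 𝔸ˣ)⁻¹) (Δ₁ := hessOp φ η (fun _ : Bond d (towerP L m (n + 1)) => (1 : 𝔸ˣ)) τ)
              (Rr := RofUk L m n φ η (fun _ : Bond d (towerP L m (n + 1)) => (1 : 𝔸ˣ)))
              (Q := (QkW L m n φ (fun _ : Bond d (towerP L m (n + 1)) => (1 : 𝔸ˣ)) hL (fun _ => 0) (fun _ => by norm_num)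
            (perCfg_UlevOf_one_mem_U1 L m (n + 1)) (norm_Wcx_UlevOf_one_sub_one_le L m (n + 1) (fun _ => 0) (fun _ => le_rfl)) (c₀ := c₀) (c₁ := c₁))) (a := a) hpos1 hQ1 b‖ ≤ C * α * ‖b‖ ∧
          ‖covCurlL2K ℂ c₀ ((η : ℂ))⁻¹ (adTransportW φ (fun _ : Bond d (towerP L m (n + 1)) => (1 : 𝔸ˣ)))
            (H1LatticeK hposU hQU b - H1LatticeK (c := ((η : ℂ))⁻¹) (R := adTransportW φ (fun _ : Bond d (towerP L m (n + 1)) => (1 : 𝔸ˣ)))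
              (S := adTransportW φ fun _ : Bond d (towerP L m (n + 1)) => (1 : 𝔸ˣ)⁻¹) (Δ₁ := hessOp φ η (fun _ : Bond d (towerP L m (n + 1)) => (1 : 𝔸ˣ)) τ)
              (Rr := RofUk L m n φ η (fun _ : Bond d (towerP L m (n + 1)) => (1 : 𝔸ˣ)))
              (Q := (QkW L m n φ (fun _ : Bond d (towerP L m (n + 1)) => (1 : 𝔸ˣ)) hL (fun _ => 0) (fun _ => by norm_num)
            (perCfg_UlevOf_one_mem_U1 L m (n + 1)) (norm_Wcx_UlevOf_one_sub_one_le L m (n + 1) (fun _ => 0) (fun _ => le_rfl)) (c₀ := c₀) (c₁ := c₁))) (a := a) hpos1 hQ1 b)‖ ≤ C * α * ‖b‖ ∧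
          ‖covDivL2K ℂ c₀ ((η : ℂ))⁻¹ (adTransportW φ fun _ : Bond d (towerP L m (n + 1)) => (1 : 𝔸ˣ)⁻¹)
            (H1LatticeK hposU hQU b - H1LatticeK (c := ((η : ℂ))⁻¹) (R := adTransportW φ (fun _ : Bond d (towerP L m (n + 1)) => (1 : 𝔸ˣ)))
              (S := adTransportW φ fun _ : Bond d (towerP L m (n + 1)) => (1 : 𝔸ˣ)⁻¹) (Δ₁ := hessOp φ η (fun _ : Bond d (towerP L m (n + 1)) => (1 : 𝔸ˣ)) τ)
              (Rr := RofUk L m n φ η (fun _ : Bond d (towerP L m (n + 1)) => (1 : 𝔸ˣ)))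
              (Q := (QkW L m n φ (fun _ : Bond d (towerP L m (n + 1)) => (1 : 𝔸ˣ)) hL (fun _ => 0) (fun _ => by norm_num)
            (perCfg_UlevOf_one_mem_U1 L m (n + 1)) (norm_Wcx_UlevOf_one_sub_one_le L m (n + 1) (fun _ => 0) (fun _ => le_rfl)) (c₀ := c₀) (c₁ := c₁))) (a := a) hpos1 hQ1 b)‖ ≤ C * α * ‖b‖ := by
  obtain ⟨α₁, γ₁, Θb, hα₁, hγ₁, hΘb, H⟩ := exists_energy_pair_diagonal_closed L hL φ hMφ hMφ' hφ hφ' ha hr0 hr1 τ hτ hCτ hρw hCR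
  have hL0 : (0 : ℝ) < L := by exact_mod_cast Nat.pos_of_ne_zero (NeZero.ne L)
  have h1r : 0 < 1 - r := by linarith
  obtain ⟨Ξ, hΞdef⟩ : ∃ Ξ : ℝ, Ξ = Real.sqrt ((L : ℝ) ^ d) * (Real.sqrt (2 * d) * (102 * (d + 1) ^ 2 * L)) := ⟨_, rfl⟩
  obtain ⟨CQ, hCQdef⟩ : ∃ CQ : ℝ, CQ = 2 * (Mφ' * Mφ) * Ξ / (1 - r) := ⟨_, rfl⟩
  have hΞ0 : 0 ≤ Ξ := by rw [hΞdef]; positivity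
  have hCQ : 0 ≤ CQ := by rw [hCQdef]; positivity
  have hMM : 0 ≤ Mφ' * Mφ := mul_nonneg hMφ' hMφ
  obtain ⟨Cb, hCbdef⟩ : ∃ Cb : ℝ, Cb = (Θb * Real.sqrt (CK1 / γ₁) + CQ * CK1) / γ₁ + Real.sqrt (CKU / γ₁) * (CQ * Real.sqrt (CK1 / γ₁)) := ⟨_, rfl⟩
  have hCb : 0 ≤ Cb := by rw [hCbdef]; positivity
  refine ⟨min α₁ ((1 - r) / (Ξ + 1)), Cb + 1, lt_min hα₁ (by positivity), by positivity, ?_⟩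
  intro n η hηL c₀ c₁ _ _ hw hρ m _ U αU hα1 hU1 hreg εU hεU hUε α hα0 hαle hRS hUb hUη hpl hεg hR hposU hpos1 hQU hQ1 hK1 hKU b
  -- scalar facts first (thin context)
  have hc₁ : 0 < c₁ := Fact.out
  have hαα₁ : α ≤ α₁ := hαle.trans (min_le_left _ _)
  have hαΞ : Ξ * (α / (1 - r)) ≤ 1 := by
    have h1 : α ≤ (1 - r) / (Ξ + 1) := hαle.trans (min_le_right _ _)
    rw [← mul_div_assoc, div_le_one h1r]
    calc Ξ * α ≤ Ξ * ((1 - r) / (Ξ + 1)) := mul_le_mul_of_nonneg_left h1 hΞ0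
      _ ≤ 1 - r := by
          rw [mul_div_assoc', div_le_iff₀ (add_pos_of_nonneg_of_pos hΞ0 one_pos)]
          calc Ξ * (1 - r) ≤ Ξ * (1 - r) + (1 - r) := le_add_of_nonneg_right h1r.le
            _ = (1 - r) * (Ξ + 1) := by ring
  have hCQα : 0 ≤ CQ * α := mul_nonneg hCQ hα0
  have hΘα : 0 ≤ Θb * α := mul_nonneg hΘb.le hα0
  have he : Real.exp (Ξ * (α / (1 - r))) - 1 ≤ 2 * (Ξ * (α / (1 - r))) :=
    exp_sub_one_le_two_mul (mul_nonneg hΞ0 (div_nonneg hα0 h1r.le)) hαΞ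
  have heM : Mφ' * Mφ * (Real.exp (Ξ * (α / (1 - r))) - 1) ≤ CQ * α := by
    have h1 := mul_le_mul_of_nonneg_left he hMM
    have h2 : Mφ' * Mφ * (2 * (Ξ * (α / (1 - r)))) = CQ * α := by rw [hCQdef]; ring
    rw [← h2]; exact h1
  have hCfin : ((Θb * α) * Real.sqrt (CK1 / γ₁) + (CQ * α) * CK1) / γ₁ + Real.sqrt (CKU / γ₁) * ((CQ * α) * Real.sqrt (CK1 / γ₁)) = Cb * α := by
    rw [hCbdef]; ring
  have hCb1 : Cb * α * ‖b‖ ≤ (Cb + 1) * α * ‖b‖ :=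
    mul_le_mul_of_nonneg_right (mul_le_mul_of_nonneg_right (le_add_of_nonneg_right zero_le_one) hα0) (norm_nonneg _)
  -- the energy data of the pair
  obtain ⟨HU, H1, HT⟩ := H n η hηL c₀ c₁ hw hρ m U αU hα1 hU1 hreg εU hεU hUε hα0 hαα₁ hRS hUb hUη hpl hεg hR
  -- the flat energy weight `N₁` (opaque)
  obtain ⟨N, hNdef⟩ : ∃ N : BondL2K ℂ d (towerP L m (n + 1)) c₀ W → ℝ, N = fun z =>
      Real.sqrt (‖covCurlL2K ℂ c₀ ((η : ℂ))⁻¹ (adTransportW φ (fun _ : Bond d (towerP L m (n + 1)) => (1 : 𝔸ˣ))) z‖ ^ 2 + ‖covDivL2K ℂ c₀ ((η : ℂ))⁻¹ (adTransportW φ fun _ : Bond d (towerP L m (n + 1)) => (1 : 𝔸ˣ)⁻¹) z‖ ^ 2 + ‖z‖ ^ 2) := ⟨_, rfl⟩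
  have hNz : ∀ z, N z = Real.sqrt (‖covCurlL2K ℂ c₀ ((η : ℂ))⁻¹ (adTransportW φ (fun _ : Bond d (towerP L m (n + 1)) => (1 : 𝔸ˣ))) z‖ ^ 2 + ‖covDivL2K ℂ c₀ ((η : ℂ))⁻¹ (adTransportW φ fun _ : Bond d (towerP L m (n + 1)) => (1 : 𝔸ˣ)⁻¹) z‖ ^ 2 + ‖z‖ ^ 2) := fun z => by rw [hNdef]
  have hN0 : ∀ z, 0 ≤ N z := fun z => by rw [hNz]; exact Real.sqrt_nonneg _
  have hNsq : ∀ z, N z ^ 2 = ‖covCurlL2K ℂ c₀ ((η : ℂ))⁻¹ (adTransportW φ (fun _ : Bond d (towerP L m (n + 1)) => (1 : 𝔸ˣ))) z‖ ^ 2 + ‖covDivL2K ℂ c₀ ((η : ℂ))⁻¹ (adTransportW φ fun _ : Bond d (towerP L m (n + 1)) => (1 : 𝔸ˣ)⁻¹) z‖ ^ 2 + ‖z‖ ^ 2 := fun z => by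
    rw [hNz]; exact Real.sq_sqrt (add_nonneg (add_nonneg (sq_nonneg _) (sq_nonneg _)) (sq_nonneg _))
  have hNn : ∀ z, ‖z‖ ≤ N z := fun z => by
    rw [hNz]; exact le_sqrt_of_sq_le (norm_nonneg _) (le_add_of_nonneg_left (add_nonneg (sq_nonneg _) (sq_nonneg _)))
  have hNc : ∀ z, ‖covCurlL2K ℂ c₀ ((η : ℂ))⁻¹ (adTransportW φ (fun _ : Bond d (towerP L m (n + 1)) => (1 : 𝔸ˣ))) z‖ ≤ N z := fun z => by
    rw [hNz]; exact le_sqrt_of_sq_le (norm_nonneg _) ((le_add_of_nonneg_right (sq_nonneg _)).trans (le_add_of_nonneg_right (sq_nonneg _)))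
  have hNd : ∀ z, ‖covDivL2K ℂ c₀ ((η : ℂ))⁻¹ (adTransportW φ fun _ : Bond d (towerP L m (n + 1)) => (1 : 𝔸ˣ)⁻¹) z‖ ≤ N z := fun z => by
    rw [hNz]; exact le_sqrt_of_sq_le (norm_nonneg _) ((le_add_of_nonneg_left (sq_nonneg _)).trans (le_add_of_nonneg_right (sq_nonneg _)))
  have hNid : ∀ z : BondL2K ℂ d (towerP L m (n + 1)) c₀ W, ‖(LinearMap.id : BondL2K ℂ d (towerP L m (n + 1)) c₀ W →ₗ[ℂ] BondL2K ℂ d (towerP L m (n + 1)) c₀ W) z‖ ≤ N z := fun z => by rw [LinearMap.id_apply]; exact hNn z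
  have hcoerU : ∀ z, γ₁ * N z ^ 2 ≤ RCLike.re ⟪z, laplaceAk L m n φ η U hL αU hα1 hU1 hreg τ (c₀ := c₀) (c₁ := c₁) a z⟫_ℂ := fun z => by rw [hNsq]; exact HU z
  have hcoer1 : ∀ z, γ₁ * N z ^ 2 ≤ RCLike.re ⟪z, laplaceAk L m n φ η (fun _ : Bond d (towerP L m (n + 1)) => (1 : 𝔸ˣ)) hL (fun _ => 0) (fun _ => by norm_num)
              (perCfg_UlevOf_one_mem_U1 L m (n + 1)) (norm_Wcx_UlevOf_one_sub_one_le L m (n + 1) (fun _ => 0) (fun _ => le_rfl)) τ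
              (c₀ := c₀) (c₁ := c₁) a z⟫_ℂ := fun z => by rw [hNsq]; exact H1 z
  have hT : ∀ u v : BondL2K ℂ d (towerP L m (n + 1)) c₀ W, ‖⟪u, laplaceAk L m n φ η U hL αU hα1 hU1 hreg τ (c₀ := c₀) (c₁ := c₁) a v⟫_ℂ - ⟪u, laplaceAk L m n φ η (fun _ : Bond d (towerP L m (n + 1)) => (1 : 𝔸ˣ)) hL (fun _ => 0) (fun _ => by norm_num)
              (perCfg_UlevOf_one_mem_U1 L m (n + 1)) (norm_Wcx_UlevOf_one_sub_one_le L m (n + 1) (fun _ => 0) (fun _ => le_rfl)) τ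
              (c₀ := c₀) (c₁ := c₁) a v⟫_ℂ‖ ≤ Θb * α * N u * N v :=
    fun u v => by rw [hNz u, hNz v]; exact HT u v
  -- δ_Q: the averaging defect (as `B9Eq353FormDefectTowerDiagonal`)
  have hQd : ∀ w : BondL2K ℂ d (towerP L m (n + 1)) c₀ W, ‖(QkW L m n φ U hL αU hα1 hU1 hreg (c₀ := c₀) (c₁ := c₁)) w - (QkW L m n φ (fun _ : Bond d (towerP L m (n + 1)) => (1 : 𝔸ˣ)) hL (fun _ => 0) (fun _ => by norm_num)
            (perCfg_UlevOf_one_mem_U1 L m (n + 1)) (norm_Wcx_UlevOf_one_sub_one_le L m (n + 1) (fun _ => 0) (fun _ => le_rfl)) (c₀ := c₀) (c₁ := c₁)) w‖ ≤ (CQ * α) * ‖w‖ := fun w => by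
    have h := norm_QkW_sub_flat_le_L2_geometric L m n hL φ hMφ hMφ' hφ hφ' (c₀ := c₀) (c₁ := c₁) U αU hα1 hU1 hreg εU hεU hUε hr0 hr1 hα0
      hεg w
    rw [sqrt_ratio_diagonal hc₁ hw, mul_one, ← hΞdef] at h
    exact h.trans (mul_le_mul_of_nonneg_right heM (norm_nonneg _))
  -- the structure letters
  have hadjU : ∀ (x : BondL2K ℂ d (towerP L m (n + 1)) c₀ W) (z : BondL2K ℂ d m c₁ W), ⟪(QkW L m n φ U hL αU hα1 hU1 hreg (c₀ := c₀) (c₁ := c₁)) x, z⟫_ℂ = ⟪x, LinearMap.adjoint (QkW L m n φ U hL αU hα1 hU1 hreg (c₀ := c₀) (c₁ := c₁)) z⟫_ℂ := fun x z => (LinearMap.adjoint_inner_right _ x z).symm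
  have hadj1 : ∀ (x : BondL2K ℂ d (towerP L m (n + 1)) c₀ W) (z : BondL2K ℂ d m c₁ W), ⟪(QkW L m n φ (fun _ : Bond d (towerP L m (n + 1)) => (1 : 𝔸ˣ)) hL (fun _ => 0) (fun _ => by norm_num)
            (perCfg_UlevOf_one_mem_U1 L m (n + 1)) (norm_Wcx_UlevOf_one_sub_one_le L m (n + 1) (fun _ => 0) (fun _ => le_rfl)) (c₀ := c₀) (c₁ := c₁)) x, z⟫_ℂ = ⟪x, LinearMap.adjoint (QkW L m n φ (fun _ : Bond d (towerP L m (n + 1)) => (1 : 𝔸ˣ)) hL (fun _ => 0) (fun _ => by norm_num)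
            (perCfg_UlevOf_one_mem_U1 L m (n + 1)) (norm_Wcx_UlevOf_one_sub_one_le L m (n + 1) (fun _ => 0) (fun _ => le_rfl)) (c₀ := c₀) (c₁ := c₁)) z⟫_ℂ :=
    fun x z => (LinearMap.adjoint_inner_right _ x z).symm
  have hinjU := adjoint_injective_of_surjective _ hQU
  have hinj1 := adjoint_injective_of_surjective _ hQ1
  -- `B9Eq3126H1LipschitzEnergy` (structure 1 := `U`, structure 0 := flat)
  refine ⟨?_, ?_, ?_⟩
  · refine le_trans ?_ hCb1
    rw [← hCfin]
    have h := norm_apply_H1K_sub_le (𝕜 := ℂ) hpos1 hadj1 hinj1 hposU hadjU hinjU N hN0 hNn hγ₁ hγ₁ hΘα hCQα hCK1 hCKU hcoerU hcoer1 hT hQd hK1 hKU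
      (LinearMap.id : BondL2K ℂ d (towerP L m (n + 1)) c₀ W →ₗ[ℂ] BondL2K ℂ d (towerP L m (n + 1)) c₀ W) hNid b
    rw [LinearMap.id_apply] at h
    exact h
  · refine le_trans ?_ hCb1
    rw [← hCfin]
    exact norm_apply_H1K_sub_le (𝕜 := ℂ) hpos1 hadj1 hinj1 hposU hadjU hinjU N hN0 hNn hγ₁ hγ₁ hΘα hCQα hCK1 hCKU hcoerU hcoer1 hT hQd hK1 hKU
      (covCurlL2K ℂ c₀ ((η : ℂ))⁻¹ (adTransportW φ (fun _ : Bond d (towerP L m (n + 1)) => (1 : 𝔸ˣ)))) hNc b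
  · refine le_trans ?_ hCb1
    rw [← hCfin]
    exact norm_apply_H1K_sub_le (𝕜 := ℂ) hpos1 hadj1 hinj1 hposU hadjU hinjU N hN0 hNn hγ₁ hγ₁ hΘα hCQα hCK1 hCKU hcoerU hcoer1 hT hQd hK1 hKU
      (covDivL2K ℂ c₀ ((η : ℂ))⁻¹ (adTransportW φ fun _ : Bond d (towerP L m (n + 1)) => (1 : 𝔸ˣ)⁻¹)) hNd b

end Literature.MathematicalPhysics.QuantumFieldTheory.Balaban1983to89.B9Eq3126H1kLipschitzEnergyDiagonal

end
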